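import Summits.Ventures.PercRepro.CogirthProfile
import Summits.Ventures.PercRepro.C025ProfileHallParallel

/-!
# PercRepro — the Hall form `H⁺_{q,u}` on every matroid of cogirth `≥ q + 1` (p9, gen 16)

The double count of `CogirthRLS` is LOCAL: it runs unchanged inside the upper shadow of any family. For a family
`𝒜` of rank-`q` finsets let `∂_u 𝒜` be the rank-`u` sets containing a member of `𝒜` (night-2's
`Shadow.shadowLevel M u 𝒜`; here `shadowFin M u 𝒜` on the `Set` side, `card_shadowLevel_eq_shadowFin`). Under rank
deficiency at `(p, q)`: `(p + q − u)·#∂_u 𝒜 ≤ (u + 1)·#∂_{u+1} 𝒜` for `u < p` (`fam_step`, `shadowFin_step`: the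
pairs `(A, e)` with `A ∈ ∂_u`, `ρ(A ∪ e) = u + 1` number `≥ p + q − u` per `A` and land in `∂_{u+1}`, at most `u + 1`
per landing set), hence `#𝒜·C(r+q, u) ≤ #∂_u 𝒜·C(r+q, q)` for `q ≤ u ≤ r = ρ(E)` (`shadowFin_mul_choose`,
`card_le_card_shadowFin`), and every price is `≤ C(r+q, u)/C(r+q, q)` (`CogirthProfile.price_le`):
**`hallIneq_of_cogirth` — `Profile.HallIneq M q u` (S5's `H⁺_{q,u}`, the Hall form of C-033) holds for every
`q ≤ u ≤ ρ(E)` on every finite matroid whose cocircuits have `≥ q + 1` elements**, and, at the pair `(p, q)` itself,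
`shadowHallLevel_of_shadowDeficient`: night-2's level-wise shadow form `ShadowHallLevel M p q u (C(p+q, u)/C(p+q, p))`
for every `q ≤ u ≤ p`. Because the count only ever visits sets ABOVE a member of the family, the hypothesis needed is
**shadow deficiency** (`ShadowDeficient M p q 𝒜`: rank deficiency on the sets of rank `< p` containing a member of
`𝒜`), and with `𝒜` = the bottom sets of `(p, q)` this gives **`rls_of_shadowDeficient`** — C-025 at `(p, q)` as soon
as every set of rank `< p` that contains a bottom set `B` (`ρ(B) = q`, `ρ(E ∖ B) = p`) has `≥ p + q − ρ` rank-increasing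
elements — the sharpest form of the criterion (`rls_of_rankDeficient` is the case of all sets). A feeder for S5 (p10's
file untouched); nothing about any window.
-/

namespace PercRepro.RankDist

open Set Finset Matroid PercRepro.ThmH

variable {α : Type}

/-- **THE DOUBLE COUNT FOR A PAIR OF FAMILIES**: `𝒮` a family of rank-`u` subsets of `E` each with at least
`p + q − u` rank-increasing elements, `𝒯` a family of rank-`(u + 1)` subsets of `E` containing `A ∪ e` for every
`A ∈ 𝒮` and every rank-increasing `e`; then `(p + q − u)·#𝒮 ≤ (u + 1)·#𝒯`. -/
theorem fam_step (M : Matroid α) [M.Finite] (p q u : ℕ)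
    (𝒮 𝒯 : Finset (Set α)) (h𝒮 : ∀ A ∈ 𝒮, A ⊆ M.E ∧ rk M A = u) (h𝒯 : ∀ A ∈ 𝒯, A ⊆ M.E ∧ rk M A = u + 1)
    (hdef : ∀ A ∈ 𝒮, p + q ≤ rk M A + (extSet M A).card)
    (hclosed : ∀ A ∈ 𝒮, ∀ e ∈ extSet M A, insert e A ∈ 𝒯) :
    (p + q - u) * 𝒮.card ≤ (u + 1) * 𝒯.card := by
  classical
  set s : Finset (Σ _ : Set α, α) := 𝒮.sigma (fun A => extSet M A) with hs
  set t : Finset (Σ _ : Set α, α) := 𝒯.sigma (fun A => dropSet M A u) with ht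
  have h1 : (p + q - u) * 𝒮.card ≤ s.card := by
    rw [hs, card_sigma, mul_comm, ← smul_eq_mul, ← Finset.sum_const]
    refine Finset.sum_le_sum fun A hA => ?_
    obtain ⟨_, hAu⟩ := h𝒮 A hA
    have := hdef A hA
    omega
  have h2 : t.card ≤ (u + 1) * 𝒯.card := by
    rw [ht, card_sigma, mul_comm, ← smul_eq_mul, ← Finset.sum_const]
    refine Finset.sum_le_sum fun A hA => ?_
    obtain ⟨hAE, hAu⟩ := h𝒯 A hA
    exact card_dropSet_le M hAE u hAu
  have h3 : s.card ≤ t.card := by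
    refine Finset.card_le_card_of_injOn (fun x => ⟨insert x.2 x.1, x.2⟩) ?_ ?_
    · intro x hx
      rw [Finset.mem_coe, hs, Finset.mem_sigma] at hx
      obtain ⟨hxS, hxe⟩ := hx
      obtain ⟨hxE, hxu⟩ := h𝒮 x.1 hxS
      have hnot : x.2 ∉ x.1 := notMem_of_mem_extSet M hxE hxe
      have hmem := hclosed x.1 hxS x.2 hxe
      rw [mem_extSet] at hxe
      rw [Finset.mem_coe, ht, Finset.mem_sigma, mem_dropSet]
      refine ⟨hmem, hxe.1, Set.mem_insert _ _, ?_⟩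
      rw [Set.insert_sdiff_self_of_notMem hnot]; exact hxu
    · intro x hx y hy hxy
      rw [Finset.mem_coe, hs, Finset.mem_sigma] at hx hy
      have hnx : x.2 ∉ x.1 := notMem_of_mem_extSet M (h𝒮 x.1 hx.1).1 hx.2
      have hny : y.2 ∉ y.1 := notMem_of_mem_extSet M (h𝒮 y.1 hy.1).1 hy.2
      simp only [Sigma.mk.inj_iff, heq_iff_eq] at hxy
      obtain ⟨hAB, hee⟩ := hxy
      rw [← hee] at hAB
      have hAB' : x.1 = y.1 := by
        rw [← Set.insert_sdiff_self_of_notMem hnx, hAB, Set.insert_sdiff_self_of_notMem (hee ▸ hny)]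
      exact Sigma.ext hAB' (heq_of_eq hee)
  omega

open scoped Classical in
/-- The upper shadow of a family `𝒜` of finsets at the rank level `u`, on the `Set` side: the subsets `A ⊆ E` of
rank `u` containing some `B ∈ 𝒜`. -/
noncomputable def shadowFin (M : Matroid α) [M.Finite] (u : ℕ) (𝒜 : Finset (Finset α)) : Finset (Set α) :=
  (subsetsFin M).filter (fun A => rk M A = u ∧ ∃ B ∈ 𝒜, (B : Set α) ⊆ A)

/-- Membership in `shadowFin`. -/
lemma mem_shadowFin (M : Matroid α) [M.Finite] {u : ℕ} {𝒜 : Finset (Finset α)} {A : Set α} :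
    A ∈ shadowFin M u 𝒜 ↔ A ⊆ M.E ∧ rk M A = u ∧ ∃ B ∈ 𝒜, (B : Set α) ⊆ A := by
  unfold shadowFin
  simp only [Finset.mem_filter, mem_subsetsFin]

/-- **Shadow deficiency at `(p, q)` over a family `𝒜`**: every `A ⊆ E` of rank `< p` containing a member of `𝒜` has
at least `p + q − ρ(A)` rank-increasing elements. Rank deficiency is the case of all sets. -/
def ShadowDeficient (M : Matroid α) [M.Finite] (p q : ℕ) (𝒜 : Finset (Finset α)) : Prop :=
  ∀ A ⊆ M.E, M.eRk A < p → (∃ B ∈ 𝒜, (B : Set α) ⊆ A) → p + q ≤ rk M A + (extSet M A).card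

/-- Rank deficiency gives shadow deficiency over every family. -/
theorem shadowDeficient_of_rankDeficient (M : Matroid α) [M.Finite] (p q : ℕ) (hdef : RankDeficient M p q)
    (𝒜 : Finset (Finset α)) : ShadowDeficient M p q 𝒜 :=
  fun A hA hlt _ => hdef A hA hlt

/-- The shadow step: under shadow deficiency at `(p, q)` over `𝒜`, `(p + q − u)·#∂_u 𝒜 ≤ (u + 1)·#∂_{u+1} 𝒜` for
`u < p`. -/
theorem shadowFin_step (M : Matroid α) [M.Finite] (p q u : ℕ) (hu : u < p) (𝒜 : Finset (Finset α))
    (hdef : ShadowDeficient M p q 𝒜) :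
    (p + q - u) * (shadowFin M u 𝒜).card ≤ (u + 1) * (shadowFin M (u + 1) 𝒜).card := by
  refine fam_step M p q u _ _ ?_ ?_ ?_ ?_
  · intro A hA
    rw [mem_shadowFin] at hA
    exact ⟨hA.1, hA.2.1⟩
  · intro A hA
    rw [mem_shadowFin] at hA
    exact ⟨hA.1, hA.2.1⟩
  · intro A hA
    rw [mem_shadowFin] at hA
    have hlt : M.eRk A < p := by
      rw [eRk_eq_coe_rk M hA.1, hA.2.1, Nat.cast_lt]; exact hu
    exact hdef A hA.1 hlt hA.2.2
  · intro A hA e he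
    rw [mem_shadowFin] at hA ⊢
    obtain ⟨hAE, hAu, B, hB, hBA⟩ := hA
    have heE : e ∈ M.E := (mem_extSet M |>.1 he).1
    refine ⟨Set.insert_subset heE hAE, ?_, B, hB, hBA.trans (Set.subset_insert _ _)⟩
    rw [rk_eq_iff M (Set.insert_subset heE hAE), (mem_extSet M |>.1 he).2, eRk_eq_coe_rk M hAE, hAu]
    push_cast; rfl

/-- Pascal's ratio along the shadow: `#∂_q 𝒜·C(r+q, u) ≤ #∂_u 𝒜·C(r+q, q)` for `q ≤ u ≤ r` under shadow
deficiency at `(r, q)` over `𝒜`. -/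
theorem shadowFin_mul_choose (M : Matroid α) [M.Finite] (r q : ℕ) (𝒜 : Finset (Finset α))
    (hdef : ShadowDeficient M r q 𝒜) :
    ∀ u, q ≤ u → u ≤ r →
      (shadowFin M q 𝒜).card * (r + q).choose u ≤ (shadowFin M u 𝒜).card * (r + q).choose q := by
  intro u hqu
  induction u, hqu using Nat.le_induction with
  | base => intro _; exact le_refl _
  | succ u hqu ih =>
    intro hup
    have ih' := ih (by omega)
    have hstep := shadowFin_step M r q u (by omega) 𝒜 hdef
    have hpas := Nat.choose_succ_right_eq (r + q) u
    have key : (shadowFin M q 𝒜).card * (r + q).choose (u + 1) * (u + 1)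
        ≤ (shadowFin M (u + 1) 𝒜).card * (r + q).choose q * (u + 1) := by
      calc (shadowFin M q 𝒜).card * (r + q).choose (u + 1) * (u + 1)
          = (shadowFin M q 𝒜).card * ((r + q).choose u * (r + q - u)) := by rw [mul_assoc, hpas]
        _ = ((shadowFin M q 𝒜).card * (r + q).choose u) * (r + q - u) := by ring
        _ ≤ ((shadowFin M u 𝒜).card * (r + q).choose q) * (r + q - u) := Nat.mul_le_mul_right _ ih'
        _ = ((r + q - u) * (shadowFin M u 𝒜).card) * (r + q).choose q := by ring
        _ ≤ ((u + 1) * (shadowFin M (u + 1) 𝒜).card) * (r + q).choose q := Nat.mul_le_mul_right _ hstep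
        _ = (shadowFin M (u + 1) 𝒜).card * (r + q).choose q * (u + 1) := by ring
    exact Nat.le_of_mul_le_mul_right key (by omega)

variable [DecidableEq α] (M : Matroid α) [M.Finite]

omit [DecidableEq α] in
/-- A family of rank-`q` finsets injects into its own shadow at level `q`. -/
theorem card_le_card_shadowFin {q : ℕ} {𝒜 : Finset (Finset α)} (h𝒜 : 𝒜 ⊆ Profile.Rq M q) :
    𝒜.card ≤ (shadowFin M q 𝒜).card := by
  refine Finset.card_le_card_of_injOn (fun B => (B : Set α)) ?_ ?_
  · intro B hB
    rw [Finset.mem_coe] at hB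
    have hBq := h𝒜 hB
    rw [Profile.mem_Rq] at hBq
    have hBE : (B : Set α) ⊆ M.E := by rw [← coe_gr M]; exact Finset.coe_subset.2 hBq.1
    rw [Finset.mem_coe, mem_shadowFin]
    exact ⟨hBE, (rk_eq_iff M hBE q).2 hBq.2, B, hB, subset_refl _⟩
  · intro B _ C _ hBC
    exact Finset.coe_injective hBC

/-- The shadow of night-2 (`Shadow.shadowLevel`, rank-`u` finsets) and `shadowFin` (rank-`u` sets) have the same
cardinality. -/
theorem card_shadowLevel_eq_shadowFin (u : ℕ) (𝒜 : Finset (Finset α)) :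
    (Shadow.shadowLevel M u 𝒜).card = (shadowFin M u 𝒜).card := by
  classical
  have hcoe : ∀ C : Set α, C ⊆ M.E → (((gr M).filter (fun e => e ∈ C) : Finset α) : Set α) = C := by
    intro C hC
    ext e
    simp only [Finset.coe_filter, mem_setOf_eq]
    exact ⟨fun h => h.2, fun h => ⟨by rw [← Finset.mem_coe, coe_gr]; exact hC h, h⟩⟩
  apply le_antisymm
  · refine Finset.card_le_card_of_injOn (fun S => (S : Set α)) ?_ ?_
    · intro S hS
      rw [Finset.mem_coe, mem_shadowLevel, Profile.mem_levelSet] at hS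
      obtain ⟨⟨hSg, hSu⟩, B, hB, hBS⟩ := hS
      have hSE : (S : Set α) ⊆ M.E := by rw [← coe_gr M]; exact Finset.coe_subset.2 hSg
      rw [Finset.mem_coe, mem_shadowFin]
      exact ⟨hSE, (rk_eq_iff M hSE u).2 hSu, B, hB, Finset.coe_subset.2 hBS⟩
    · intro S _ T _ hST
      exact Finset.coe_injective hST
  · refine Finset.card_le_card_of_injOn (fun A => (gr M).filter (fun e => e ∈ A)) ?_ ?_
    · intro A hA
      rw [Finset.mem_coe, mem_shadowFin] at hA
      obtain ⟨hAE, hAu, B, hB, hBA⟩ := hA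
      rw [Finset.mem_coe, mem_shadowLevel, Profile.mem_levelSet, hcoe A hAE]
      refine ⟨⟨Finset.filter_subset _ _, (rk_eq_iff M hAE u).1 hAu⟩, B, hB, ?_⟩
      rw [← Finset.coe_subset, hcoe A hAE]
      exact hBA
    · intro A hA B hB hAB
      rw [Finset.mem_coe, mem_shadowFin] at hA hB
      rw [← hcoe A hA.1, ← hcoe B hB.1]
      simp only at hAB
      rw [hAB]

/-- **`H⁺_{q,u}` UNDER RANK DEFICIENCY**: on a matroid of rank `r`, rank deficiency at `(r, q)` gives the Hall
inequality at `(q, u)` for every `q ≤ u ≤ r`. -/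
theorem hallIneq_of_rankDeficient (q u r : ℕ) (hr : M.eRank = (r : ℕ∞)) (hqu : q ≤ u) (hur : u ≤ r)
    (hdef : RankDeficient M r q) : Profile.HallIneq M q u := by
  intro 𝒜 h𝒜
  rw [card_shadowLevel_eq_shadowFin]
  have hsum : ∑ B ∈ 𝒜, Profile.price M q u B
      ≤ (𝒜.card : ℚ) * (((r + q).choose u : ℚ) / ((r + q).choose q : ℚ)) := by
    have := Finset.sum_le_card_nsmul 𝒜 (fun B => Profile.price M q u B)
      (((r + q).choose u : ℚ) / ((r + q).choose q : ℚ)) (fun B _ => price_le M q u r hr hqu B)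
    simpa [nsmul_eq_mul] using this
  refine hsum.trans ?_
  have hd : (0 : ℚ) < ((r + q).choose q : ℚ) := by exact_mod_cast Nat.choose_pos (by omega)
  rw [← mul_div_assoc, div_le_iff₀ hd]
  have h1 := card_le_card_shadowFin M h𝒜
  have h2 := shadowFin_mul_choose M r q 𝒜 (shadowDeficient_of_rankDeficient M r q hdef 𝒜) u hqu hur
  have h3 : 𝒜.card * (r + q).choose u ≤ (shadowFin M u 𝒜).card * (r + q).choose q :=
    (Nat.mul_le_mul_right _ h1).trans h2
  exact_mod_cast h3

/-- **THE HALL FORM ON EVERY MATROID OF COGIRTH `≥ q + 1`**: if every set of rank `ρ(E) − 1` misses at least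
`q + 1` elements of `E` in its closure (every cocircuit has `≥ q + 1` elements), then `H⁺_{q,u}` holds for every
`q ≤ u ≤ ρ(E)`. -/
theorem hallIneq_of_cogirth (q u r : ℕ) (hr : M.eRank = (r : ℕ∞)) (hqu : q ≤ u) (hur : u ≤ r)
    (hhyp : ∀ A ⊆ M.E, M.eRk A + 1 = (r : ℕ∞) → q + 1 ≤ (M.E \ M.closure A).ncard) :
    Profile.HallIneq M q u :=
  hallIneq_of_rankDeficient M q u r hr hqu hur (rankDeficient_of_hyperplanes M r q r hr le_rfl hhyp)

/-- **THE LEVEL-WISE SHADOW FORM OF C-025 AT `(p, q)` UNDER SHADOW DEFICIENCY** (night-2's `ShadowHallLevel` with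
the constant `C(p+q, u)/C(p+q, p)` of `ShadowC025Level`): shadow deficiency at `(p, q)` over the bottom sets gives,
for every family `𝒜` of bottom sets of `(p, q)` and every `q ≤ u ≤ p`, `C(p+q, u)/C(p+q, p)·#𝒜 ≤ #∂_u 𝒜`. -/
theorem shadowHallLevel_of_shadowDeficient (p q u : ℕ) (hqu : q ≤ u) (hup : u ≤ p)
    (hdef : ShadowDeficient M p q (PerFlat.Uq M p q)) :
    Shadow.ShadowHallLevel M p q u (((p + q).choose u : ℚ) / ((p + q).choose p : ℚ)) := by
  intro 𝒜 h𝒜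
  rw [card_shadowLevel_eq_shadowFin]
  have h𝒜' : 𝒜 ⊆ Profile.Rq M q := h𝒜.trans (Profile.Uq_subset_Rq p q)
  have hdef' : ShadowDeficient M p q 𝒜 := fun A hA hlt ⟨B, hB, hBA⟩ => hdef A hA hlt ⟨B, h𝒜 hB, hBA⟩
  have hd : (0 : ℚ) < ((p + q).choose p : ℚ) := by exact_mod_cast Nat.choose_pos (by omega)
  rw [div_mul_eq_mul_div, div_le_iff₀ hd]
  have h1 := card_le_card_shadowFin M h𝒜'
  have h2 := shadowFin_mul_choose M p q 𝒜 hdef' u hqu hup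
  have h3 : (p + q).choose u * 𝒜.card ≤ (shadowFin M u 𝒜).card * (p + q).choose p := by
    rw [Nat.choose_symm_add, mul_comm]
    exact (Nat.mul_le_mul_right _ h1).trans h2
  exact_mod_cast h3

/-- The level-wise shadow form at `(p, q)` under rank deficiency at `(p, q)`. -/
theorem shadowHallLevel_of_rankDeficient (p q u : ℕ) (hqu : q ≤ u) (hup : u ≤ p) (hdef : RankDeficient M p q) :
    Shadow.ShadowHallLevel M p q u (((p + q).choose u : ℚ) / ((p + q).choose p : ℚ)) :=
  shadowHallLevel_of_shadowDeficient M p q u hqu hup (shadowDeficient_of_rankDeficient M p q hdef _)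

omit [DecidableEq α] in
/-- The shadow at level `u` is a sub-family of the rank-`u` sets. -/
theorem card_shadowFin_le_levelCount (u : ℕ) (𝒜 : Finset (Finset α)) :
    (shadowFin M u 𝒜).card ≤ levelCount M u := by
  rw [levelCount]
  refine Finset.card_le_card fun A hA => ?_
  rw [mem_shadowFin] at hA
  rw [mem_filter, mem_subsetsFin]
  exact ⟨hA.1, hA.2.1⟩

/-- **C-025 UNDER SHADOW DEFICIENCY OVER THE BOTTOM SETS** — the sharpest form of the criterion: if every `A ⊆ E` of
rank `< p` containing a bottom set `B` of `(p, q)` (`ρ(B) = q`, `ρ(E ∖ B) = p`) has at least `p + q − ρ(A)`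
rank-increasing elements, then `ThmN.RLS M p q`. -/
theorem rls_of_shadowDeficient (p q : ℕ) (hdef : ShadowDeficient M p q (PerFlat.Uq M p q)) :
    ThmN.RLS M p q := by
  unfold ThmN.RLS phiK
  have hU := PerFlat.ncard_U_le_card_Uq M p q
  rw [ncard_Y_eq_sum M p q]
  have hpos : (0 : ℚ) < ((p + q).choose p : ℚ) := by
    exact_mod_cast Nat.choose_pos (by omega)
  rw [div_mul_eq_mul_div, div_le_iff₀ hpos]
  have key : (∑ u ∈ Ioo q p, (p + q).choose u)
      * {A : Set α | A ⊆ M.E ∧ M.eRk A = (p : ℕ∞) ∧ M.eRk (M.E \ A) = (q : ℕ∞)}.ncard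
      ≤ (∑ u ∈ Ioo q p, levelCount M u) * (p + q).choose p := by
    calc (∑ u ∈ Ioo q p, (p + q).choose u)
          * {A : Set α | A ⊆ M.E ∧ M.eRk A = (p : ℕ∞) ∧ M.eRk (M.E \ A) = (q : ℕ∞)}.ncard
        ≤ (∑ u ∈ Ioo q p, (p + q).choose u) * (PerFlat.Uq M p q).card := Nat.mul_le_mul_left _ hU
      _ = ∑ u ∈ Ioo q p, (PerFlat.Uq M p q).card * (p + q).choose u := by
          rw [Finset.sum_mul]; exact Finset.sum_congr rfl fun u _ => mul_comm _ _
      _ ≤ ∑ u ∈ Ioo q p, (shadowFin M u (PerFlat.Uq M p q)).card * (p + q).choose q := by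
          refine Finset.sum_le_sum fun u hu => ?_
          rw [Finset.mem_Ioo] at hu
          have h1 := card_le_card_shadowFin M (Profile.Uq_subset_Rq (M := M) p q)
          have h2 := shadowFin_mul_choose M p q (PerFlat.Uq M p q) hdef u (by omega) (by omega)
          exact (Nat.mul_le_mul_right _ h1).trans h2
      _ ≤ ∑ u ∈ Ioo q p, levelCount M u * (p + q).choose q := by
          refine Finset.sum_le_sum fun u _ => ?_
          exact Nat.mul_le_mul_right _ (card_shadowFin_le_levelCount M u _)
      _ = (∑ u ∈ Ioo q p, levelCount M u) * (p + q).choose p := by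
          rw [Finset.sum_mul, Nat.choose_symm_add]
  exact_mod_cast key

end PercRepro.RankDist
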